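import Summits.QuantumFields.QCD.Theorems.PauliWegnerSeaChiralGluonicCompletionGlobalContinuum
import Summits.QuantumFields.QCD.Theorems.QuarksAsStableActionStableActionBridgeTransferLevelBounds
import Summits.QuantumFields.QCD.Theorems.WilsonMobilityGapChiralGluonicCompletionStubUniformNormGap
import Literature.MathematicalPhysics.QuantumFieldTheory.QCDTransferMatrix
import Literature.MathematicalPhysics.QuantumFieldTheory.QCDAsymptoticScalingCouplingDivergence

/-!
# Crux `ChiralGluonicCompletion` (stmt-QuantumFields-17498), line `Sketch_ideator5_r2` — stub `stub_coldPressure` (P₂):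
# typing audit, supplier search, and the sorry-free typing lemmas (stub NOT proved: `stub-blocked`)

AUDIT (stub worker, 2026-08-17; this file only SUPPORTS the item — the stub itself is `stub-blocked`).
(1) TYPING. `qcdTransferLevel N_f (2S+1) β m n` = real `sInf` over `Φ : Fin n → core` of `sSup` of Rayleigh quotients on
`{Ψ ∈ core, 𝔫(Ψ,Ψ) ≠ 0, 𝔫(Φ i,Ψ) = 0}`; junk outside `β ≥ 0`, `m_f > −1`.  Along a `Hyp`-witness (`N_f ∈ {2,3}`) the
couplings are EVENTUALLY in that range (`β_k → +∞` by asymptotic scaling, `m_f(k) > −1` by clause (i):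
`uniformNormGap_rangeGuard`, landed by the sibling worker), where `0 < λ₀`, `0 ≤ λ_{j+1} ≤ λ₀` (landed `qcdTransferLevel_zero_pos/_antitone`), so
every summand `(λ_{j+1}/λ₀)^{S+1} ∈ [0,1]` (§2): no division junk; the `∀ᶠ k` absorbs the junk range.  `Summable` is not
derivable from landed facts (only levels 0, 1 are tied to the `L²` realisation — `qcdTransferLevel_eq_embedded_levels`,
`transfer_cluster`, `qcdTransferLevel_one_pos`; nothing on `n ≥ 2`, `λ_n → 0`, `Σ λ_n^p < ∞`) but TRUE in range for
every `S` (Courant–Fischer over the dense core = eigenvalues with multiplicity of the compact positive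
`𝕋 = T̂_F^{1/2}T̂_U T̂_F^{1/2}`; `T̂_U` has a continuous positive-definite kernel on compact `SU(3)^E`, so `𝕋` is trace
class).  VERDICT: meaningful, not vacuous / junk-vulnerable / trivially false; content = the ONE constant (cold pressure,
aspect ratio 2, all `N_t = S+1 ≥ L_k+1`).  Same Boltzmann sum as crux 9737's `TwistedTraceTransfer.LowTemperaturePressureAt`
(PARTIAL sums `Σ_{n<M}(λ_{n+1}/λ₀)^t ≤ C e^{−Δth a_k t}`, `t ≥ θS`): the typings agree eventually by non-negativity
(`coldPressure_iff_partialSums`); P₂ = that clause at `θ = 1`, `t = S+1`, rate dropped (`coldPressure_of_lowTemperaturePressure`).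
9737's `stub_torusDenominators_spectral` sums `λᵢ^N` over an ABSTRACT eigenbasis (`Summable (λᵢ²)`), tying only the top
level to `qcdTransferLevel … 0`: consuming or supplying P₂ AS TYPED needs the full min–max dictionary
`Tr 𝕋^N = Σ_n (qcdTransferLevel … n)^N` (unproved; the assembly stub's burden either way).
(2) SUPPLIERS (`Theses/CounterexampleMustBeHot.lean`). `ThetaPlusTransport` (10191, `∀ reg`): CONDITIONAL on the
finite-volume certificate `ColdFin` (one `N_t = ⌈1/(a_kT₁)⌉`) and `Lim`, concludes `ColdBelow` for the INFINITE-volume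
count `F_k(N') = (90/π²)N'⁴(e₀(k) − φ_k(N'))`, not finite tori; `GapImpliesCold` (18760, `∀ reg`): premise
`(reg.scheme m 0 0).HasLatticeMassGap ε` = C1, the node P₂ serves (circular), infinite-volume too;
`ChiralColdCertificate` (17303) / `ColdHotWitness` (18758): `∃ reg`, not the given witness; `FreeEnergyLimits` (18759):
existence of limits only.  All in Berezin-`Z_AP` currency on `ZMod N_t × (Fin 3 → ZMod N_s)`: even `ColdFin` for the
GIVEN reg at all `N_t ≥ L_k+1` reaches P₂ only via `‖Z_AP‖ = Σ_n λ_n^{N_t}` (representation identity + min–max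
dictionary, unproved) and a finite-size bound `N_t(E₀(N_s) − N_s³e₀(k)) = O(1)` (FINDINGS-ideator4-r2 F4 overlooks the
finite/infinite-volume mismatch).  9737's `thermal_smallness_le_of_hasMassGap` is `(dim H − 1)e^{−mL}`, finite-dim only.
No conjunction of existing items gives P₂ for a given `Hyp`-witness; nearest named statement:
`CounterexampleMustBeHot.ChiralColdCertificate` (its `ColdFin` clause, ∃-form; stmt-QuantumFields-17303).
-/

noncomputable section

open MeasureTheory Filter Topology Matrix
open scoped Matrix.Norms.L2Operator ComplexOrder
open Literature.MathematicalPhysics.QuantumFieldTheory Literature.MathematicalPhysics.QuantumLattice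
  Literature.Probability.LatticeModels
open Summit.QuantumFields.QCD.Theorems.StronglyChiralSubsequence
open Summit.QuantumFields.QCD.Cruxes.StableActionBridge.Sketch

namespace Summit.QuantumFields.QCD.Theorems.AnomalyBranch

variable {Nf : ℕ}

/-! ## §1 Along a `Hyp`-witness the couplings are eventually in Lüscher's range: LANDED as
`uniformNormGap_rangeGuard` (wave-1 sibling worker, `Theorems/WilsonMobilityGapChiralGluonicCompletionStubUniformNormGap.lean`,
imported and reused below). -/

/-! ## §2 In range every thermal summand lies in `[0, 1]` -/

/-- In Lüscher's range the Boltzmann ratio `λ_{j+1}/λ₀` of the min–max levels on the spatial torus of side `2S+1`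
is non-negative (`0 ≤ λ_{j+1}`, `0 < λ₀`). -/
theorem thermalRatio_nonneg (S : ℕ) {β : ℝ} {mq : Fin Nf → ℝ} (hβ : 0 ≤ β) (hmq : ∀ f, -1 < mq f) (j : ℕ) :
    0 ≤ qcdTransferLevel Nf (2 * S + 1) β mq (j + 1) / qcdTransferLevel Nf (2 * S + 1) β mq 0 :=
  div_nonneg ((qcdTransferLevel_antitone Nf (2 * S + 1) β mq hβ hmq).2 _)
    (TransferLevelBounds.qcdTransferLevel_zero_pos hβ hmq).le

/-- In Lüscher's range the Boltzmann ratio `λ_{j+1}/λ₀` is at most `1` (the levels are antitone, `λ₀ > 0`). -/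
theorem thermalRatio_le_one (S : ℕ) {β : ℝ} {mq : Fin Nf → ℝ} (hβ : 0 ≤ β) (hmq : ∀ f, -1 < mq f) (j : ℕ) :
    qcdTransferLevel Nf (2 * S + 1) β mq (j + 1) / qcdTransferLevel Nf (2 * S + 1) β mq 0 ≤ 1 :=
  (div_le_one (TransferLevelBounds.qcdTransferLevel_zero_pos hβ hmq)).2
    ((qcdTransferLevel_antitone Nf (2 * S + 1) β mq hβ hmq).1 (Nat.zero_le _))

/-- In Lüscher's range every thermal summand `(λ_{j+1}/λ₀)^p` is non-negative. -/
theorem thermalSummand_nonneg (S : ℕ) {β : ℝ} {mq : Fin Nf → ℝ} (hβ : 0 ≤ β) (hmq : ∀ f, -1 < mq f) (j p : ℕ) :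
    0 ≤ (qcdTransferLevel Nf (2 * S + 1) β mq (j + 1) / qcdTransferLevel Nf (2 * S + 1) β mq 0) ^ p :=
  pow_nonneg (thermalRatio_nonneg S hβ hmq j) p

/-- In Lüscher's range every thermal summand `(λ_{j+1}/λ₀)^p` is at most `1`. -/
theorem thermalSummand_le_one (S : ℕ) {β : ℝ} {mq : Fin Nf → ℝ} (hβ : 0 ≤ β) (hmq : ∀ f, -1 < mq f) (j p : ℕ) :
    (qcdTransferLevel Nf (2 * S + 1) β mq (j + 1) / qcdTransferLevel Nf (2 * S + 1) β mq 0) ^ p ≤ 1 :=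
  pow_le_one₀ (thermalRatio_nonneg S hβ hmq j) (thermalRatio_le_one S hβ hmq j)

/-! ## §3 The two typings of the cold-pressure bound agree along a `Hyp`-witness -/

/-- **`Summable ∧ ∑' ≤ C` versus bounded partial sums.**  Along a `Hyp`-witness (`N_f ∈ {2,3}`) and at a positive
tuple, the conclusion of `stub_coldPressure` — one constant bounding the SUMMABLE thermal entropy sum
`Σ'_{j} (λ_{j+1}/λ₀)^{S+1}` on all tori `S ≥ L_k`, eventually in `k` — is equivalent to the junk-free typing by
PARTIAL sums used by crux 9737's `LowTemperaturePressureAt` (`∀ M, Σ_{j<M} (λ_{j+1}/λ₀)^{S+1} ≤ C`): eventually the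
summands are non-negative (§1–§2), so bounded partial sums give summability and the `tsum` bound
(`summable_of_sum_range_le`, `Real.tsum_le_of_sum_range_le`), and conversely partial sums are below the `tsum`. -/
theorem coldPressure_iff_partialSums : ∀ Nf : ℕ, Nf = 2 ∨ Nf = 3 → ∀ reg : QCDRegularisation Nf, Hyp Nf reg →
    ∀ m : Fin Nf → ℝ, (∀ f, 0 < m f) →
    ((∃ C : ℝ, ∀ᶠ k in atTop, ∀ S : ℕ, reg.L k ≤ S →
        Summable (fun j : ℕ =>
            (qcdTransferLevel Nf (2 * S + 1) (reg.β k) (fun f => reg.mcrit k + reg.a k * m f / reg.Zm k) (j + 1) /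
                qcdTransferLevel Nf (2 * S + 1) (reg.β k) (fun f => reg.mcrit k + reg.a k * m f / reg.Zm k) 0) ^
              (S + 1)) ∧
          ∑' j : ℕ,
              (qcdTransferLevel Nf (2 * S + 1) (reg.β k) (fun f => reg.mcrit k + reg.a k * m f / reg.Zm k) (j + 1) /
                  qcdTransferLevel Nf (2 * S + 1) (reg.β k) (fun f => reg.mcrit k + reg.a k * m f / reg.Zm k) 0) ^
                (S + 1) ≤ C) ↔
    (∃ C : ℝ, ∀ᶠ k in atTop, ∀ S : ℕ, reg.L k ≤ S → ∀ M : ℕ,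
        ∑ j ∈ Finset.range M,
            (qcdTransferLevel Nf (2 * S + 1) (reg.β k) (fun f => reg.mcrit k + reg.a k * m f / reg.Zm k) (j + 1) /
                qcdTransferLevel Nf (2 * S + 1) (reg.β k) (fun f => reg.mcrit k + reg.a k * m f / reg.Zm k) 0) ^
              (S + 1) ≤ C)) := by
  intro Nf hNf reg hH m hm
  constructor
  · rintro ⟨C, hC⟩
    refine ⟨C, ?_⟩
    filter_upwards [hC, uniformNormGap_rangeGuard hNf reg hH m hm] with k hk hr S hS M
    obtain ⟨hsum, hle⟩ := hk S hS
    exact (hsum.sum_le_tsum (Finset.range M) fun j _ => thermalSummand_nonneg S hr.1 hr.2 j (S + 1)).trans hle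
  · rintro ⟨C, hC⟩
    refine ⟨C, ?_⟩
    filter_upwards [hC, uniformNormGap_rangeGuard hNf reg hH m hm] with k hk hr S hS
    have h0 : ∀ j : ℕ, 0 ≤
        (qcdTransferLevel Nf (2 * S + 1) (reg.β k) (fun f => reg.mcrit k + reg.a k * m f / reg.Zm k) (j + 1) /
            qcdTransferLevel Nf (2 * S + 1) (reg.β k) (fun f => reg.mcrit k + reg.a k * m f / reg.Zm k) 0) ^
          (S + 1) := fun j => thermalSummand_nonneg S hr.1 hr.2 j (S + 1)
    exact ⟨summable_of_sum_range_le h0 (hk S hS), Real.tsum_le_of_sum_range_le h0 (hk S hS)⟩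

/-- **P₂ from the low-temperature pressure clause of crux 9737.**  Along a `Hyp`-witness (`N_f ∈ {2,3}`) and at a
positive tuple `m`, the clause `TwistedTraceTransfer.LowTemperaturePressureAt (reg.scheme m 0 0) Δth` of line
`twisted_trace_transfer` (crux stmt-QuantumFields-9737; spelled out here, `Cruxes/` not being importable: for every
aspect parameter `θ > 0` one constant bounds every partial Boltzmann sum `Σ_{n<M} (λ_{n+1}/λ₀)^t` by
`C e^{−Δth a_k t}` on all tori `S ≥ L_k` and all extents `t ≥ θ S`, eventually in `k`), with any rate `Δth ≥ 0`,
implies the conclusion of `stub_coldPressure`: take `θ = 1`, `t = S + 1` and drop the exponential. -/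
theorem coldPressure_of_lowTemperaturePressure (hNf : Nf = 2 ∨ Nf = 3) (reg : QCDRegularisation Nf) (hH : Hyp Nf reg)
    (m : Fin Nf → ℝ) (hm : ∀ f, 0 < m f) {Δth : ℝ} (hΔ : 0 ≤ Δth)
    (hLT : ∀ θ : ℝ, 0 < θ → ∃ C : ℝ, ∀ᶠ k in atTop, ∀ S : ℕ, reg.L k ≤ S → ∀ t : ℕ, θ * S ≤ t → ∀ M : ℕ,
      ∑ n ∈ Finset.range M,
          (qcdTransferLevel Nf (2 * S + 1) (reg.β k) (fun f => reg.mcrit k + reg.a k * m f / reg.Zm k) (n + 1) /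
              qcdTransferLevel Nf (2 * S + 1) (reg.β k) (fun f => reg.mcrit k + reg.a k * m f / reg.Zm k) 0) ^ t ≤
        C * Real.exp (-(Δth * (reg.a k * t)))) :
    ∃ C : ℝ, ∀ᶠ k in atTop, ∀ S : ℕ, reg.L k ≤ S →
      Summable (fun j : ℕ =>
          (qcdTransferLevel Nf (2 * S + 1) (reg.β k) (fun f => reg.mcrit k + reg.a k * m f / reg.Zm k) (j + 1) /
              qcdTransferLevel Nf (2 * S + 1) (reg.β k) (fun f => reg.mcrit k + reg.a k * m f / reg.Zm k) 0) ^
            (S + 1)) ∧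
        ∑' j : ℕ,
            (qcdTransferLevel Nf (2 * S + 1) (reg.β k) (fun f => reg.mcrit k + reg.a k * m f / reg.Zm k) (j + 1) /
                qcdTransferLevel Nf (2 * S + 1) (reg.β k) (fun f => reg.mcrit k + reg.a k * m f / reg.Zm k) 0) ^
              (S + 1) ≤ C := by
  obtain ⟨C, hC⟩ := hLT 1 one_pos
  refine (coldPressure_iff_partialSums Nf hNf reg hH m hm).2 ⟨max C 0, ?_⟩
  filter_upwards [hC] with k hk S hS M
  have ht : (1 : ℝ) * (S : ℝ) ≤ ((S + 1 : ℕ) : ℝ) := by push_cast; linarith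
  refine (hk S hS (S + 1) ht M).trans ?_
  have hexp : Real.exp (-(Δth * (reg.a k * ((S + 1 : ℕ) : ℝ)))) ≤ 1 := by
    rw [Real.exp_le_one_iff, neg_nonpos]
    exact mul_nonneg hΔ (mul_nonneg (reg.a_pos k).le (Nat.cast_nonneg _))
  calc C * Real.exp (-(Δth * (reg.a k * ((S + 1 : ℕ) : ℝ))))
      ≤ max C 0 * Real.exp (-(Δth * (reg.a k * ((S + 1 : ℕ) : ℝ)))) :=
        mul_le_mul_of_nonneg_right (le_max_left _ _) (Real.exp_pos _).le
    _ ≤ max C 0 * 1 := mul_le_mul_of_nonneg_left hexp (le_max_right _ _)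
    _ = max C 0 := mul_one _

end Summit.QuantumFields.QCD.Theorems.AnomalyBranch

end
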